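import Summits.AtomisticToContinuum.Crystallization.Theses.PhononSlackCertificates
import Summits.AtomisticToContinuum.Crystallization.Theorems.PhononSlackCertificatesPeriodicGivenLayeredClosing2

/-!
# `PeriodicGivenLayered` (stmt-AtomisticToContinuum-11779), line `Sketch`, stub `stub_closing` — part 3

**Part A of the density closing: a uniformly recurrent layered set in the hull of a sequence of
Lennard-Jones ground states has no stacking fault** (lead prover-line-stmt-AtomisticToContinuum-11779-0).

If `s (m₀+1) = s m₀` somewhere, uniform recurrence (block length `2`) puts a fault in every window of
`G + 1` consecutive layers (`clo_count`: at least `n'` faults among `n'(G+1)` consecutive layers). On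
the prism `W(0, n, K)` of the layered set `S` (word `s`) and the prism `W'` of the restacked set `S'`
(alternating word, SAME heights `z`, same `a, A`), the layer cake of `stub_layerCake` turns the site
energies into `K² Σ_m ε_m`, the per-layer price `clo_layer_price` (part 2) gives
`Σ_m (ε_m(s) − ε_m(alt)) ≥ c₀ · #faults ≥ c₀ n'`, while the hull upper bound (U) for `W ⊆ S` and the
free lower bound (L) for `W' ⊆ S'` of `stub_windowBounds` — at the SAME cardinality `nK²`, so that the
ground-state energies `2E(nK²)` cancel — leave only boundary terms `≤ (|C_U| + |C_L|)·C·(nK + K²)`.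
With `K = n = n'(G+1)` this reads `c₀ n' ≤ 2(|C_U| + |C_L|)C`, absurd for `n'` large (`clo_partA`).
-/

noncomputable section

namespace Summit.AtomisticToContinuum.Crystallization.Theorems.LayeredHull

open scoped BigOperators
open Finset Filter Literature.MathematicalPhysics.StatisticalMechanics

/-! ## Counting recurrent events in a window -/

/-- **Counting.** If every position `m` sees the event `P` at some `m + g`, `0 ≤ g ≤ G`, then among the
`n'(G+1)` consecutive positions starting at `m₁` the event happens at least `n'` times. [folklore] -/
theorem clo_count (P : ℤ → Prop) [DecidablePred P] (G : ℕ) (m₁ : ℤ)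
    (h : ∀ m : ℤ, ∃ g : ℤ, 0 ≤ g ∧ g ≤ G ∧ P (m + g)) (n' : ℕ) :
    (n' : ℝ) ≤ ∑ m ∈ Finset.Ico m₁ (m₁ + ((n' * (G + 1) : ℕ) : ℤ)), (if P m then (1 : ℝ) else 0) := by
  induction n' with
  | zero => simp
  | succ n ih =>
    have hnn : ∀ m ∈ Finset.Ico (m₁ + ((n * (G + 1) : ℕ) : ℤ)) (m₁ + (((n + 1) * (G + 1) : ℕ) : ℤ)),
        (0 : ℝ) ≤ if P m then (1 : ℝ) else 0 := fun m _ => by split_ifs <;> norm_num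
    have hsplit : Finset.Ico m₁ (m₁ + (((n + 1) * (G + 1) : ℕ) : ℤ)) =
        Finset.Ico m₁ (m₁ + ((n * (G + 1) : ℕ) : ℤ)) ∪
          Finset.Ico (m₁ + ((n * (G + 1) : ℕ) : ℤ)) (m₁ + (((n + 1) * (G + 1) : ℕ) : ℤ)) := by
      rw [Finset.Ico_union_Ico_eq_Ico]
      · push_cast; nlinarith
      · push_cast; nlinarith
    rw [hsplit, Finset.sum_union (Finset.Ico_disjoint_Ico_consecutive _ _ _)]
    obtain ⟨g, hg0, hgG, hP⟩ := h (m₁ + ((n * (G + 1) : ℕ) : ℤ))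
    have hmem : m₁ + ((n * (G + 1) : ℕ) : ℤ) + g ∈
        Finset.Ico (m₁ + ((n * (G + 1) : ℕ) : ℤ)) (m₁ + (((n + 1) * (G + 1) : ℕ) : ℤ)) := by
      rw [Finset.mem_Ico]
      have hgG' : (g : ℤ) ≤ (G : ℤ) := by exact_mod_cast hgG
      constructor
      · linarith
      · push_cast; nlinarith
    have hlast : (1 : ℝ) ≤ ∑ m ∈ Finset.Ico (m₁ + ((n * (G + 1) : ℕ) : ℤ)) (m₁ + (((n + 1) * (G + 1) : ℕ) : ℤ)),
        (if P m then (1 : ℝ) else 0) := by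
      have := Finset.single_le_sum hnn hmem
      rwa [if_pos hP] at this
    push_cast at ih hlast ⊢
    linarith

/-! ## Small real-arithmetic helpers -/

/-- Absorbing a boundary term: `X ≤ E + c·B`, `0 ≤ B ≤ M` give `X ≤ E + |c|·M`. [folklore] -/
theorem clo_absorb_upper {X E c B M : ℝ} (h : X ≤ E + c * B) (hB : B ≤ M) (hB0 : 0 ≤ B) :
    X ≤ E + |c| * M := by
  have h1 : c * B ≤ |c| * B := mul_le_mul_of_nonneg_right (le_abs_self c) hB0
  have h2 : |c| * B ≤ |c| * M := mul_le_mul_of_nonneg_left hB (abs_nonneg c)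
  linarith

/-- Absorbing a boundary term: `E − c·B ≤ X`, `0 ≤ B ≤ M` give `E − |c|·M ≤ X`. [folklore] -/
theorem clo_absorb_lower {X E c B M : ℝ} (h : E - c * B ≤ X) (hB : B ≤ M) (hB0 : 0 ≤ B) :
    E - |c| * M ≤ X := by
  have h1 : c * B ≤ |c| * B := mul_le_mul_of_nonneg_right (le_abs_self c) hB0
  have h2 : |c| * B ≤ |c| * M := mul_le_mul_of_nonneg_left hB (abs_nonneg c)
  linarith

/-! ## Part A: no stacking fault -/

/-- **Part A of the closing.** A uniformly recurrent layered set in the hull of a sequence of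
Lennard-Jones ground states has no stacking fault: `s (m+1) = −s m` for every `m`, given the window
bounds (U), (L), the registry facts and the layer cake (hypotheses verbatim as in `stub_closing`; the
increment convexity is not needed here). [folklore] -/
theorem clo_partA (x : (N : ℕ) → (Fin N → (EuclideanSpace ℝ (Fin 3)))) (hx : ∀ N, IsGroundState lennardJones (x N))
    (a : ℝ) (ha : 47 / 50 ≤ a) (ha1 : a ≤ 1) (A : (EuclideanSpace ℝ (Fin 3)) →ₗᵢ[ℝ] (EuclideanSpace ℝ (Fin 3))) (s : ℤ → ℤ) (z : ℤ → ℝ)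
    (hs : IsHaggSeq s) (hz : ∀ m : ℤ, 39 / 50 * a ≤ z (m + 1) - z m ∧ z (m + 1) - z m ≤ 17 / 20 * a)
    (hrec : ∀ (n : ℕ) (η : ℝ), 0 < η → ∀ m₀ : ℤ, ∃ G : ℕ, ∀ m : ℤ, ∃ g : ℤ, 0 ≤ g ∧ g ≤ G ∧
      ∀ k : ℕ, k < n → s (m + g + k) = s (m₀ + k) ∧
        |(z (m + g + k + 1) - z (m + g + k)) - (z (m₀ + k + 1) - z (m₀ + k))| ≤ η)
    (hH : let S : Set (EuclideanSpace ℝ (Fin 3)) := {p | ∃ m i j : ℤ, p = A (((i : ℝ) • triangularVec₁ a) +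
        ((j : ℝ) • triangularVec₂ a) + ((haggLabel s m : ℝ) • barlowOffset a) + (z m • layerNormal 1))};
      ∀ R ε : ℝ, 0 < ε → ∃ᶠ N in atTop, ∃ t : (EuclideanSpace ℝ (Fin 3)),
        (∀ p ∈ S, ‖p‖ ≤ R → ∃ i : Fin N, dist (x N i + t) p ≤ ε) ∧
        (∀ i : Fin N, ‖x N i + t‖ ≤ R → ∃ p ∈ S, dist (x N i + t) p ≤ ε))
    (hU : ∃ C : ℝ, ∀ x : (N : ℕ) → (Fin N → (EuclideanSpace ℝ (Fin 3))), (∀ N, IsGroundState lennardJones (x N)) →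
      ∀ S : Set (EuclideanSpace ℝ (Fin 3)), (∀ R ε : ℝ, 0 < ε → ∃ᶠ N in atTop, ∃ t : (EuclideanSpace ℝ (Fin 3)),
        (∀ p ∈ S, ‖p‖ ≤ R → ∃ i : Fin N, dist (x N i + t) p ≤ ε) ∧
        (∀ i : Fin N, ‖x N i + t‖ ≤ R → ∃ p ∈ S, dist (x N i + t) p ≤ ε)) →
      ∀ W : Finset (EuclideanSpace ℝ (Fin 3)), (↑W : Set (EuclideanSpace ℝ (Fin 3))) ⊆ S →
        ∑ p ∈ W, (∑' q : {q : (EuclideanSpace ℝ (Fin 3)) // q ∈ S ∧ q ≠ p}, lennardJones (dist p (q : (EuclideanSpace ℝ (Fin 3))))) ≤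
          2 * groundStateEnergy lennardJones 3 W.card +
            C * ∑ p ∈ W, (1 + Metric.infDist p (S \ (↑W : Set (EuclideanSpace ℝ (Fin 3)))))⁻¹ ^ 3)
    (hL : ∀ δ : ℝ, 0 < δ → ∃ C : ℝ, ∀ S : Set (EuclideanSpace ℝ (Fin 3)), (∀ p ∈ S, ∀ q ∈ S, p ≠ q → δ ≤ dist p q) →
      ∀ W : Finset (EuclideanSpace ℝ (Fin 3)), (↑W : Set (EuclideanSpace ℝ (Fin 3))) ⊆ S →
        2 * groundStateEnergy lennardJones 3 W.card -
            C * ∑ p ∈ W, (1 + Metric.infDist p (S \ (↑W : Set (EuclideanSpace ℝ (Fin 3)))))⁻¹ ^ 3 ≤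
          ∑ p ∈ W, (∑' q : {q : (EuclideanSpace ℝ (Fin 3)) // q ∈ S ∧ q ≠ p}, lennardJones (dist p (q : (EuclideanSpace ℝ (Fin 3))))))
    (hreg : ∃ c₀ : ℝ, 0 < c₀ ∧ ∀ a : ℝ, 47 / 50 ≤ a → a ≤ 1 →
      (∀ H H' : ℝ, 39 / 25 * a ≤ H → H ≤ H' →
        barlowCoupling lennardJones a H' 1 ≤ 0 ∧
          barlowCoupling lennardJones a H 1 ≤ barlowCoupling lennardJones a H' 1) ∧
      c₀ ≤ barlowCoupling lennardJones a (117 / 50 * a) 1 - barlowCoupling lennardJones a (17 / 10 * a) 1)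
    (hcake : ∃ C : ℝ, ∀ a : ℝ, 47 / 50 ≤ a → a ≤ 1 →
      (∀ (H : ℝ) (δ : ℤ), 7 / 10 ≤ |H| → |layerInteraction lennardJones a H δ 1| ≤ C / H ^ 4) ∧
      ∀ (A : (EuclideanSpace ℝ (Fin 3)) →ₗᵢ[ℝ] (EuclideanSpace ℝ (Fin 3))) (s : ℤ → ℤ) (z : ℤ → ℝ), IsHaggSeq s →
        (∀ m : ℤ, 39 / 50 * a ≤ z (m + 1) - z m ∧ z (m + 1) - z m ≤ 17 / 20 * a) →
        let S : Set (EuclideanSpace ℝ (Fin 3)) := {p | ∃ m i j : ℤ, p = A (((i : ℝ) • triangularVec₁ a) +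
          ((j : ℝ) • triangularVec₂ a) + ((haggLabel s m : ℝ) • barlowOffset a) + (z m • layerNormal 1))};
        (∀ p ∈ S, ∀ q ∈ S, p ≠ q → 1 / 2 ≤ dist p q) ∧
        (∀ m : ℤ, Summable fun m' : ℤ => if m' = m then (0 : ℝ) else
          layerInteraction lennardJones a (z m' - z m) (haggLabel s m' - haggLabel s m) 1) ∧
        (∀ m i j : ℤ,
          (∑' q : {q : (EuclideanSpace ℝ (Fin 3)) // q ∈ S ∧ q ≠ A (((i : ℝ) • triangularVec₁ a) + ((j : ℝ) • triangularVec₂ a) +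
              ((haggLabel s m : ℝ) • barlowOffset a) + (z m • layerNormal 1))},
            lennardJones (dist (A (((i : ℝ) • triangularVec₁ a) + ((j : ℝ) • triangularVec₂ a) +
              ((haggLabel s m : ℝ) • barlowOffset a) + (z m • layerNormal 1))) (q : (EuclideanSpace ℝ (Fin 3))))) =
          inLayerInteraction lennardJones a + ∑' m' : ℤ, if m' = m then (0 : ℝ) else
            layerInteraction lennardJones a (z m' - z m) (haggLabel s m' - haggLabel s m) 1) ∧
        (∀ (m₁ : ℤ) (n K : ℕ),
          let W : Finset (EuclideanSpace ℝ (Fin 3)) := ((Finset.Ico m₁ (m₁ + n)) ×ˢ ((Finset.range K) ×ˢ (Finset.range K))).image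
            fun t : ℤ × (ℕ × ℕ) => A (((((t.2.1 : ℤ) - haggLabel s t.1 / 3 : ℤ) : ℝ) • triangularVec₁ a) +
              ((((t.2.2 : ℤ) - haggLabel s t.1 / 3 : ℤ) : ℝ) • triangularVec₂ a) +
              ((haggLabel s t.1 : ℝ) • barlowOffset a) + (z t.1 • layerNormal 1));
          (↑W : Set (EuclideanSpace ℝ (Fin 3))) ⊆ S ∧ W.card = n * K ^ 2 ∧
          (∑ p ∈ W, (∑' q : {q : (EuclideanSpace ℝ (Fin 3)) // q ∈ S ∧ q ≠ p}, lennardJones (dist p (q : (EuclideanSpace ℝ (Fin 3)))))) =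
            (K : ℝ) ^ 2 * ∑ m ∈ Finset.Ico m₁ (m₁ + n), (inLayerInteraction lennardJones a +
              ∑' m' : ℤ, if m' = m then (0 : ℝ) else
                layerInteraction lennardJones a (z m' - z m) (haggLabel s m' - haggLabel s m) 1) ∧
          (∑ p ∈ W, (1 + Metric.infDist p (S \ (↑W : Set (EuclideanSpace ℝ (Fin 3)))))⁻¹ ^ 3) ≤ C * (n * K + K ^ 2))) :
    ∀ m : ℤ, s (m + 1) = -s m := by
  classical
  by_contra hcon
  simp only [not_forall] at hcon
  obtain ⟨m₀, hm₀⟩ := hcon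
  -- unpack the constants
  obtain ⟨CU, hU'⟩ := hU
  obtain ⟨CL, hL'⟩ := hL (1 / 2) (by norm_num)
  obtain ⟨c₀, hc₀, hreg'⟩ := hreg
  obtain ⟨hreg1, hreg2⟩ := hreg' a ha ha1
  obtain ⟨Cc, hcake'⟩ := hcake
  obtain ⟨hdecay, hcakeA⟩ := hcake' a ha ha1
  obtain ⟨-, hsumS, -, hprismS⟩ := hcakeA A s z hs hz
  obtain ⟨hsepA, hsumA, -, hprismA⟩ := hcakeA A alternatingHagg z isHaggSeq_alternating hz
  have hCc : 0 ≤ Cc := by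
    have h1 := hdecay 1 0 (by norm_num)
    have : (0 : ℝ) ≤ Cc / 1 ^ 4 := (abs_nonneg _).trans h1
    simpa using this
  -- the fault recurs with gap `G`
  obtain ⟨G, hG⟩ := hrec 2 1 one_pos m₀
  have hfault : ∀ m : ℤ, ∃ g : ℤ, 0 ≤ g ∧ g ≤ G ∧ ¬ (s (m + g + 1) = -s (m + g)) := by
    intro m
    obtain ⟨g, hg0, hgG, hk⟩ := hG m
    refine ⟨g, hg0, hgG, ?_⟩
    have h0 := (hk 0 (by norm_num)).1
    have h1 := (hk 1 (by norm_num)).1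
    simp only [Nat.cast_zero, add_zero, Nat.cast_one] at h0 h1
    rw [h1, h0]
    exact hm₀
  -- the number of blocks `n'` and the prism size `n = K = n'(G+1)`
  obtain ⟨n', hn'⟩ := exists_nat_gt (2 * ((|CU| + |CL|) * Cc) / c₀)
  have hn'pos : 0 < n' := by
    have h0 : (0 : ℝ) ≤ 2 * ((|CU| + |CL|) * Cc) / c₀ := by positivity
    exact_mod_cast h0.trans_lt hn'
  have hnpos : 0 < n' * (G + 1) := Nat.mul_pos hn'pos (Nat.succ_pos G)
  have hKpos : (0 : ℝ) < ((n' * (G + 1) : ℕ) : ℝ) := by exact_mod_cast hnpos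
  -- the two prisms (`m₁ = 0`, `n` layers, `K = n`)
  obtain ⟨hWsub, hWcard, hWsum, hWbd⟩ := hprismS 0 (n' * (G + 1)) (n' * (G + 1))
  obtain ⟨hW'sub, hW'card, hW'sum, hW'bd⟩ := hprismA 0 (n' * (G + 1)) (n' * (G + 1))
  -- (U) for `W ⊆ S` (in the hull) and (L) for `W' ⊆ S'` (`1/2`-separated), same cardinality
  have hUw := hU' x hx _ hH _ hWsub
  have hLw := hL' _ hsepA _ hW'sub
  rw [hWcard, hWsum] at hUw
  rw [hW'card, hW'sum] at hLw
  have hUw' := clo_absorb_upper hUw hWbd (Finset.sum_nonneg fun p _ =>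
    pow_nonneg (inv_nonneg.2 (add_nonneg zero_le_one Metric.infDist_nonneg)) 3)
  have hLw' := clo_absorb_lower hLw hW'bd (Finset.sum_nonneg fun p _ =>
    pow_nonneg (inv_nonneg.2 (add_nonneg zero_le_one Metric.infDist_nonneg)) 3)
  -- per-layer price, summed over the block
  have hprice : ∀ m : ℤ, c₀ * (if s (m + 1) = -s m then (0 : ℝ) else 1) ≤
      (∑' m' : ℤ, if m' = m then (0 : ℝ) else
          layerInteraction lennardJones a (z m' - z m) (haggLabel s m' - haggLabel s m) 1) -
      (∑' m' : ℤ, if m' = m then (0 : ℝ) else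
          layerInteraction lennardJones a (z m' - z m)
            (haggLabel alternatingHagg m' - haggLabel alternatingHagg m) 1) := fun m =>
    clo_layer_price ha hs hz hdecay hreg1 hreg2 m (hsumS m) (hsumA m)
  have hsum_price : c₀ * ∑ m ∈ Finset.Ico (0 : ℤ) (0 + ((n' * (G + 1) : ℕ) : ℤ)),
      (if s (m + 1) = -s m then (0 : ℝ) else 1) ≤
      (∑ m ∈ Finset.Ico (0 : ℤ) (0 + ((n' * (G + 1) : ℕ) : ℤ)), (inLayerInteraction lennardJones a +
        (∑' m' : ℤ, if m' = m then (0 : ℝ) else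
          layerInteraction lennardJones a (z m' - z m) (haggLabel s m' - haggLabel s m) 1))) -
      ∑ m ∈ Finset.Ico (0 : ℤ) (0 + ((n' * (G + 1) : ℕ) : ℤ)), (inLayerInteraction lennardJones a +
        (∑' m' : ℤ, if m' = m then (0 : ℝ) else
          layerInteraction lennardJones a (z m' - z m)
            (haggLabel alternatingHagg m' - haggLabel alternatingHagg m) 1)) := by
    rw [Finset.mul_sum, ← Finset.sum_sub_distrib]
    refine Finset.sum_le_sum fun m _ => ?_
    have := hprice m
    linarith
  -- counting the faults
  have hcount : (n' : ℝ) ≤ ∑ m ∈ Finset.Ico (0 : ℤ) (0 + ((n' * (G + 1) : ℕ) : ℤ)),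
      (if s (m + 1) = -s m then (0 : ℝ) else 1) := by
    have := clo_count (fun m => ¬ (s (m + 1) = -s m)) G 0 (fun m => hfault m) n'
    refine this.trans (le_of_eq (Finset.sum_congr rfl fun m _ => ?_))
    simp only [ite_not]
  -- the energy inequality `K² · c₀ n' ≤ (|CU| + |CL|) Cc (nK + K²)` with `K = n`
  have hmain : ((n' * (G + 1) : ℕ) : ℝ) ^ 2 * (c₀ * n') ≤
      (|CU| + |CL|) * (Cc * (((n' * (G + 1) : ℕ) : ℝ) * ((n' * (G + 1) : ℕ) : ℝ) +
        ((n' * (G + 1) : ℕ) : ℝ) ^ 2)) := by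
    have h1 : ((n' * (G + 1) : ℕ) : ℝ) ^ 2 * (c₀ * n') ≤
        ((n' * (G + 1) : ℕ) : ℝ) ^ 2 * (c₀ * ∑ m ∈ Finset.Ico (0 : ℤ) (0 + ((n' * (G + 1) : ℕ) : ℤ)),
          (if s (m + 1) = -s m then (0 : ℝ) else 1)) :=
      mul_le_mul_of_nonneg_left (mul_le_mul_of_nonneg_left hcount hc₀.le) (by positivity)
    have h2 := mul_le_mul_of_nonneg_left hsum_price (show (0 : ℝ) ≤ ((n' * (G + 1) : ℕ) : ℝ) ^ 2 by positivity)
    nlinarith [h1, h2, hUw', hLw', abs_nonneg CU, abs_nonneg CL]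
  -- divide by `K² > 0`: `c₀ n' ≤ 2 (|CU| + |CL|) Cc`, contradicting the choice of `n'`
  have hK2 : (0 : ℝ) < ((n' * (G + 1) : ℕ) : ℝ) ^ 2 := by positivity
  have hdiv : c₀ * n' ≤ 2 * ((|CU| + |CL|) * Cc) := by
    have e : (|CU| + |CL|) * (Cc * (((n' * (G + 1) : ℕ) : ℝ) * ((n' * (G + 1) : ℕ) : ℝ) +
        ((n' * (G + 1) : ℕ) : ℝ) ^ 2)) = ((n' * (G + 1) : ℕ) : ℝ) ^ 2 * (2 * ((|CU| + |CL|) * Cc)) := by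
      ring
    rw [e] at hmain
    exact le_of_mul_le_mul_left hmain hK2
  have : (n' : ℝ) ≤ 2 * ((|CU| + |CL|) * Cc) / c₀ := by
    rw [le_div_iff₀ hc₀]; linarith
  linarith

end Summit.AtomisticToContinuum.Crystallization.Theorems.LayeredHull

end
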